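import Literature.MathematicalPhysics.QuantumFieldTheory.ConformalBootstrap3D.PointKernelK34v2Data
import Literature.MathematicalPhysics.QuantumFieldTheory.ConformalBootstrap3D.PointKernelParts

/-!
# K34v2 certificate, kernel part file P28: one-cell head segments 144, 145 in level ranges

The head cells whose kernel evaluation exceeds one `decide` are one-cell segments of `hsegsK34v2`; each is
checked by `PCert.hPartSideOK` (side conditions) and `PCert.hPartOK` per level range `[n_lo, n_lo + count)`
against an integer claim, the claims summing to `≥ 0` (`PointKernel.partsOK`); soundness is
`PCert.hParts_sound` (`PointKernelParts`).  The part files `P1, P2, …` are mutually independent (each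
imports only the data file); the ranges of one cell may span several of them, and the per-cell
conclusions `hparts_i` / `hcell_i` of those cells are assembled in `PointKernelK34v2.lean`.
Estimated kernel time 247 s.
-/

set_option maxRecDepth 100000
set_option maxHeartbeats 0

namespace Literature.MathematicalPhysics.QuantumFieldTheory.ConformalBootstrap3D.PointKernelK34v2

open Literature.MathematicalPhysics.QuantumFieldTheory.ConformalBootstrap3D.PointKernel

/-- levels `[56, 61)` of segment 144: partial lower sum `≥` claim. [folklore] -/
theorem part_144_4 : certK34v2.hPartOK (PCert.segAt hsegsK34v2 144) JHK34v2 56 5 (787383704576434049180532676658360995) = true := by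
  decide +kernel

/-- levels `[61, 65)` of segment 144: partial lower sum `≥` claim. [folklore] -/
theorem part_144_5 : certK34v2.hPartOK (PCert.segAt hsegsK34v2 144) JHK34v2 61 4 (379299185568456362026660040106067760) = true := by
  decide +kernel

/-- one-cell segment 145 (row 6, cell `[14339/2048, 3585/512]`, chord, `n_F = 72`,
10 level ranges): side conditions. [folklore] -/
theorem pside_145 : certK34v2.hPartSideOK (PCert.segAt hsegsK34v2 145) JHK34v2 = true := by
  decide +kernel

/-- its level ranges `(n_lo, count, claim)`. [folklore] -/
def parts_145 : List (ℕ × ℕ × ℤ) := [(0, 25, -43138436505063112016836456652915126308), (25, 11, 27388098317358088564369709484182805357), (36, 8, 9163038974372070244216004492064994695), (44, 6, 3314085913331557650284901406792279812), (50, 5, 1513978681492577280591913279100368984), (55, 5, 870852861176706844788427798627425329), (60, 4, 419303733340023255761629966224093982), (64, 4, 267488764022884604408475948888169902), (68, 3, 134489837664100955314552757714112253), (71, 2, 67099422305102617100841519320876002)]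

/-- the ranges tile `[0, n_F]` and the claims sum to `≥ 0`. [folklore] -/
theorem pcov_145 : PointKernel.partsOK 72 parts_145 = true := by
  decide +kernel

/-- levels `[0, 25)` of segment 145: partial lower sum `≥` claim. [folklore] -/
theorem part_145_0 : certK34v2.hPartOK (PCert.segAt hsegsK34v2 145) JHK34v2 0 25 (-43138436505063112016836456652915126308) = true := by
  decide +kernel

/-- levels `[25, 36)` of segment 145: partial lower sum `≥` claim. [folklore] -/
theorem part_145_1 : certK34v2.hPartOK (PCert.segAt hsegsK34v2 145) JHK34v2 25 11 (27388098317358088564369709484182805357) = true := by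
  decide +kernel

end Literature.MathematicalPhysics.QuantumFieldTheory.ConformalBootstrap3D.PointKernelK34v2
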